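import Summits.CriticalPhenomena.PercolationContinuityZ3.Theorems.PercNearOneGluingNoHeavyQuantFourAtomsHeavy
import Summits.CriticalPhenomena.PercolationContinuityZ3.Theorems.PercNearOneGluingNoHeavyQuantGluedPairSDEC
import HarnessLib

/-!
# QUANT lane R8, T-DEC: THREE EQUAL BLOBS ARE HEAVY-DEC AT THEIR AVERAGE GATE, and the lift `ρ ∗ ρ ∗ gate_c ρ` (two sure glued
# siblings beside a gated copy) is DEC at floor `(2+c)g/3` — every shape `(r, k)`, long tails included (prim-quant-census-2 gen 80)

builds on p205010 (kernel theorem, internal audit signed; external expert review pending)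

Support file (`--supports stmt-CriticalPhenomena-4575`), QUANT lane census seat prim-quant-census-2 (gen 80); memo
`run/shared/lean/prim/quant/prim-quant-census-2-g80/TRIPLE-G80.md` §2–§3.  Theorems only, standard axioms, no sorries, no definitions.

THE BLOB LEMMA (**`heavy_threeBlobs`**).  The law of `k·(ξ₁ + ξ₂ + ζ)`, `ξᵢ ~ Bernoulli(g)`, `ζ ~ Bernoulli(c·g)` independent — written as the
mixture `(1−c)·[k·Bin(2,g)] + c·[k·Bin(3,g)]` on the atoms `0, k, 2k, 3k` — carries a HEAVY decomposition (`…QuantHeavyShift`: pairs with gate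
`≥ x` and credit `≥ T`, self-sufficient points) at the floor `x = (2+c)g/3` = the AVERAGE gate = mean/top, and the target `T = (2+c)g·k` = its mean.
Three regimes: `(2+c)g ≤ 1` — the zero atom is absorbed EXACTLY by `k, 2k, 3k` at the credit gates `3x, 3x/2, x` (the identity
`Σ_b b·p_b = 3x`); `1 < (2+c)g ≤ 2` — `k` stands alone, the zero is absorbed by `2k, 3k` (slack `p₁((2+c)g − 1)`); `(2+c)g > 2` — the lows `0` and
`k` ship to `3k` and `2k, 3k` at the floor gate (two polynomial inequalities in `(c, g)`).
THE LIFT (**`decAtT_twoSureOneGated`**).  `X_c = ρ ∗ ρ ∗ gate_c ρ`, `ρ = blobLaw [(k,g),(r,1)]`, is the blob law above with the gated copy's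
atoms moved up by `r` (a PARTIAL shift, `heavy_shift_partial`: same target) and everything moved up by `2r` (a FULL shift, `heavy_shift_full`:
target `+4r ≥ (2+c)r`); hence `X_c` is `DECAtT ((2+c)g/3) ((2+c)(r+kg)) j` at EVERY layer `j` — the floor `(2+c)g/3` is ABOVE the natural floor
`c·g` of the forest.  No `ConvClosedT` budget split achieves this for long tails (`k ≥ 30r`, memo §1): the blobs of the sure copies must absorb
the gated copy's deficit jointly, which is what the blob lemma does.  USE: the polarized component of the identical glued triple's outer-gate
mixture (`…QuantGluedTripleTrueFloor`).

HONEST STATUS.  `SiblingStep`, `FarTreeRow` OPEN; RATE class (log\*) / honest sentence of `run/shared/lean/prim/quant/README.md` unchanged.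
[this work].  Nothing here is cited as a published result.  The gluing rows served [cite: KozmaNitzan2024, Conjecture 3 (p. 15)]; product
measure [cite: Grimmett1999, §1.3 p. 10].
-/

noncomputable section

open scoped BigOperators

namespace Summit.CriticalPhenomena.PercolationContinuityZ3.Theorems
namespace Quant

open Finset

/-- the two-point law `{lo, hi; g}` (as in `…QuantLawDEC`) -/
local notation3 "TP[" lo ", " hi ", " g ", " h "]" =>
  (g : ℝ) * (if (h : ℕ) = (hi : ℕ) then (1 : ℝ) else 0) + (1 - (g : ℝ)) * (if (h : ℕ) = (lo : ℕ) then (1 : ℝ) else 0)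

namespace LawDec

/-! ### Three equal blobs at the average gate -/

/-- **THREE EQUAL BLOBS ARE HEAVY-DEC AT THEIR AVERAGE GATE.**  For `0 < g < 1`, `0 < c ≤ 1` and a blob size `k`, the law
`(1−c)·[k·Bin(2,g)] + c·[k·Bin(3,g)]` (three independent blobs of size `k` with gates `g, g, cg`) on `{0..3k}` is an exact mixture of components
`{lo, hi; γ}` with `γ ≥ (2+c)g/3` and credit `2lo + (hi−lo)γ ≥ (2+c)g·k` (its mean).  Floor `(2+c)g/3` = the average gate. [this work] -/
theorem heavy_threeBlobs (k : ℕ) {g c : ℝ} (hg0 : 0 < g) (hg1 : g < 1) (hc0 : 0 < c) (hc1 : c ≤ 1) :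
    ∃ (ι : Type) (_ : Fintype ι) (lam γ : ι → ℝ) (lo hi : ι → ℕ),
      (∀ i, 0 ≤ lam i) ∧ (∑ i, lam i = 1) ∧ (∀ i, 0 ≤ γ i ∧ γ i ≤ 1) ∧ (∀ i, lo i ≤ hi i) ∧ (∀ i, hi i ≤ 3 * k) ∧
      (∀ h, ((1 - c) * ((1 - g) ^ 2 * (if h = 0 then (1 : ℝ) else 0) + 2 * g * (1 - g) * (if h = k then (1 : ℝ) else 0)
                + g ^ 2 * (if h = 2 * k then (1 : ℝ) else 0))
            + c * ((1 - g) ^ 3 * (if h = 0 then (1 : ℝ) else 0) + 3 * g * (1 - g) ^ 2 * (if h = k then (1 : ℝ) else 0)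
                + 3 * g ^ 2 * (1 - g) * (if h = 2 * k then (1 : ℝ) else 0) + g ^ 3 * (if h = 3 * k then (1 : ℝ) else 0)))
          = ∑ i, lam i * TP[lo i, hi i, γ i, h]) ∧
      (∀ i, 0 < lam i → (2 + c) * g / 3 ≤ γ i ∧ (2 + c) * g * k ≤ 2 * (lo i : ℝ) + ((hi i : ℝ) - lo i) * γ i) := by
  -- the four atoms and their mass / mean
  have h1g : 0 < 1 - g := by linarith
  have hcg1 : c * g < 1 := by nlinarith
  have hp₀0 : 0 ≤ (1 - g) ^ 2 * (1 - c * g) := mul_nonneg (sq_nonneg _) (by linarith)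
  have hp₁0 : 0 ≤ g * (1 - g) * (2 + c - 3 * c * g) := mul_nonneg (mul_nonneg hg0.le h1g.le) (by nlinarith)
  have hp₂0 : 0 ≤ g ^ 2 * (1 + 2 * c - 3 * c * g) := mul_nonneg (sq_nonneg _) (by nlinarith)
  have hp₃0 : 0 ≤ c * g ^ 3 := by positivity
  have hsum : (1 - g) ^ 2 * (1 - c * g) + g * (1 - g) * (2 + c - 3 * c * g) + g ^ 2 * (1 + 2 * c - 3 * c * g) + c * g ^ 3 = 1 := by
    ring
  have hmean : g * (1 - g) * (2 + c - 3 * c * g) + 2 * (g ^ 2 * (1 + 2 * c - 3 * c * g)) + 3 * (c * g ^ 3) = (2 + c) * g := by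
    ring
  have hs0 : 0 < (2 + c) * g := by positivity
  have hlaw : ∀ h : ℕ, ((1 - c) * ((1 - g) ^ 2 * (if h = 0 then (1 : ℝ) else 0) + 2 * g * (1 - g) * (if h = k then (1 : ℝ) else 0)
                + g ^ 2 * (if h = 2 * k then (1 : ℝ) else 0))
            + c * ((1 - g) ^ 3 * (if h = 0 then (1 : ℝ) else 0) + 3 * g * (1 - g) ^ 2 * (if h = k then (1 : ℝ) else 0)
                + 3 * g ^ 2 * (1 - g) * (if h = 2 * k then (1 : ℝ) else 0) + g ^ 3 * (if h = 3 * k then (1 : ℝ) else 0)))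
      = (1 - g) ^ 2 * (1 - c * g) * (if h = 0 then (1 : ℝ) else 0) + g * (1 - g) * (2 + c - 3 * c * g) * (if h = k then (1 : ℝ) else 0)
        + g ^ 2 * (1 + 2 * c - 3 * c * g) * (if h = 2 * k then (1 : ℝ) else 0) + c * g ^ 3 * (if h = 3 * k then (1 : ℝ) else 0) :=
    fun h => by ring
  -- the three regimes of `s = (2+c)g`
  have main : ∃ (ι : Type) (_ : Fintype ι) (lam γ : ι → ℝ) (lo hi : ι → ℕ),
      (∀ i, 0 ≤ lam i) ∧ (∑ i, lam i = 1) ∧ (∀ i, 0 ≤ γ i ∧ γ i ≤ 1) ∧ (∀ i, lo i ≤ hi i) ∧ (∀ i, hi i ≤ 3 * k) ∧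
      (∀ h, ((1 - g) ^ 2 * (1 - c * g) * (if h = 0 then (1 : ℝ) else 0)
          + g * (1 - g) * (2 + c - 3 * c * g) * (if h = k then (1 : ℝ) else 0)
          + g ^ 2 * (1 + 2 * c - 3 * c * g) * (if h = 2 * k then (1 : ℝ) else 0) + c * g ^ 3 * (if h = 3 * k then (1 : ℝ) else 0))
          = ∑ i, lam i * TP[lo i, hi i, γ i, h]) ∧
      (∀ i, 0 < lam i → (2 + c) * g / 3 ≤ γ i ∧ (2 + c) * g * k ≤ 2 * (lo i : ℝ) + ((hi i : ℝ) - lo i) * γ i) := by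
    rcases le_or_gt ((2 + c) * g) 1 with h1 | h1
    · exact heavy_fourAtoms_small k _ _ _ _ _ hp₀0 hp₁0 hp₂0 hp₃0 hsum hmean hs0 h1
    rcases le_or_gt ((2 + c) * g) 2 with h2 | h2
    · exact heavy_fourAtoms_mid k _ _ _ _ _ hp₀0 hp₁0 hp₂0 hp₃0 hsum hmean hs0 h1 h2
    · have hs3 : (2 + c) * g < 3 := by nlinarith
      exact heavy_fourAtoms_large k _ _ _ _ _ hp₀0 hp₁0 hp₂0 hp₃0 hsum hmean hs0 h2 hs3
        (threeBlobs_ineq_zero c g hc0 hc1 hg0 hg1 h2) (threeBlobs_ineq_lows c g hc0 hc1 hg0 hg1 h2)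
  obtain ⟨ι, hι, lam, γ, lo, hi, h0, h1, hγ, hlohi, hhi, hμ, hval⟩ := main
  exact ⟨ι, hι, lam, γ, lo, hi, h0, h1, hγ, hlohi, hhi, fun h => (hlaw h).trans (hμ h), hval⟩


/-! ### Indicator bookkeeping -/

/-- re-addressing an indicator. -/
theorem ind_congr {n m : ℕ} (e : n = m) (h : ℕ) : (if h = n then (1 : ℝ) else 0) = (if h = m then (1 : ℝ) else 0) := by
  subst e; rfl

/-- an indicator read after a shift: `[h − s = a] = [h = s + a]` for `s ≤ h`. -/
theorem ind_sub {s h : ℕ} (hs : s ≤ h) (a : ℕ) : (if h - s = a then (1 : ℝ) else 0) = (if h = s + a then (1 : ℝ) else 0) := by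
  by_cases hc : h - s = a
  · rw [if_pos hc, if_pos (by omega)]
  · rw [if_neg hc, if_neg (by omega)]

/-! ### The glued sibling and its convolution powers, atom by atom -/

/-- `ρ = blobLaw [(k,g),(r,1)] = (1−g)·δ_r + g·δ_{k+r}`. [this work] -/
theorem glued_eq_pointLaws (r k : ℕ) (g : ℝ) :
    blobLaw [(k, g), (r, 1)] = fun h => (1 - g) * pointLaw r h + g * pointLaw (k + r) h :=
  funext fun h => blobLaw_pair_sure_apply k r g h

/-- `ρ ∗ ρ = (1−g)²·δ_{2r} + 2g(1−g)·δ_{2r+k} + g²·δ_{2r+2k}`. [this work] -/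
theorem glued_sq_apply (r k : ℕ) (g : ℝ) (h : ℕ) :
    lconv (r + k) (r + k) (blobLaw [(k, g), (r, 1)]) (blobLaw [(k, g), (r, 1)]) h
      = (1 - g) ^ 2 * pointLaw (2 * r) h + 2 * g * (1 - g) * pointLaw (2 * r + k) h + g ^ 2 * pointLaw (2 * r + 2 * k) h := by
  rw [glued_eq_pointLaws, lconv_lin_left, lconv_lin_right, lconv_lin_right,
    lconv_pointLaw _ _ r r (by omega) (by omega), lconv_pointLaw _ _ r (k + r) (by omega) (by omega),
    lconv_pointLaw _ _ (k + r) r (by omega) (by omega), lconv_pointLaw _ _ (k + r) (k + r) (by omega) (by omega),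
    show r + r = 2 * r by ring, show r + (k + r) = 2 * r + k by ring, show k + r + r = 2 * r + k by ring,
    show k + r + (k + r) = 2 * r + 2 * k by ring]
  ring

/-- `ρ ∗ ρ ∗ ρ = Σ_b C(3,b) g^b (1−g)^{3−b} · δ_{3r+bk}`. [this work] -/
theorem glued_cube_apply (r k : ℕ) (g : ℝ) (h : ℕ) :
    lconv ((r + k) + (r + k)) (r + k) (lconv (r + k) (r + k) (blobLaw [(k, g), (r, 1)]) (blobLaw [(k, g), (r, 1)]))
        (blobLaw [(k, g), (r, 1)]) h
      = (1 - g) ^ 3 * pointLaw (3 * r) h + 3 * g * (1 - g) ^ 2 * pointLaw (3 * r + k) h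
        + 3 * g ^ 2 * (1 - g) * pointLaw (3 * r + 2 * k) h + g ^ 3 * pointLaw (3 * r + 3 * k) h := by
  have e2 : lconv (r + k) (r + k) (blobLaw [(k, g), (r, 1)]) (blobLaw [(k, g), (r, 1)])
      = fun h => (1 - g) ^ 2 * pointLaw (2 * r) h + 2 * g * (1 - g) * pointLaw (2 * r + k) h
          + g ^ 2 * pointLaw (2 * r + 2 * k) h := funext (glued_sq_apply r k g)
  rw [e2, glued_eq_pointLaws, lconv_lin3_left, lconv_lin_right, lconv_lin_right, lconv_lin_right,
    lconv_pointLaw _ _ (2 * r) r (by omega) (by omega), lconv_pointLaw _ _ (2 * r) (k + r) (by omega) (by omega),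
    lconv_pointLaw _ _ (2 * r + k) r (by omega) (by omega), lconv_pointLaw _ _ (2 * r + k) (k + r) (by omega) (by omega),
    lconv_pointLaw _ _ (2 * r + 2 * k) r (by omega) (by omega),
    lconv_pointLaw _ _ (2 * r + 2 * k) (k + r) (by omega) (by omega),
    show 2 * r + r = 3 * r by ring, show 2 * r + (k + r) = 3 * r + k by ring, show 2 * r + k + r = 3 * r + k by ring,
    show 2 * r + k + (k + r) = 3 * r + 2 * k by ring, show 2 * r + 2 * k + r = 3 * r + 2 * k by ring,
    show 2 * r + 2 * k + (k + r) = 3 * r + 3 * k by ring]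
  ring

/-- **`X_c = ρ ∗ ρ ∗ gate_c ρ` atom by atom**: `(1−c)·(ρ∗ρ) + c·(ρ∗ρ∗ρ)`. [this work] -/
theorem twoSureOneGated_apply (r k : ℕ) (g c : ℝ) (h : ℕ) :
    lconv ((r + k) + (r + k)) (r + k) (lconv (r + k) (r + k) (blobLaw [(k, g), (r, 1)]) (blobLaw [(k, g), (r, 1)]))
        (gate (blobLaw [(k, g), (r, 1)]) c) h
      = (1 - c) * ((1 - g) ^ 2 * pointLaw (2 * r) h + 2 * g * (1 - g) * pointLaw (2 * r + k) h + g ^ 2 * pointLaw (2 * r + 2 * k) h)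
        + c * ((1 - g) ^ 3 * pointLaw (3 * r) h + 3 * g * (1 - g) ^ 2 * pointLaw (3 * r + k) h
            + 3 * g ^ 2 * (1 - g) * pointLaw (3 * r + 2 * k) h + g ^ 3 * pointLaw (3 * r + 3 * k) h) := by
  rw [lconv_gate_right _ _ _ _ _ (fun t ht => lconv_eq_zero _ _ _ _ t ht) h, glued_cube_apply, glued_sq_apply]
  ring

/-- **the same law as the doubly shifted blob law**: `X_c h = [2r ≤ h]·( (1−c)B₂(h−2r) + [r ≤ h−2r]·c·B₃(h−3r) )`, `B₂ = k·Bin(2,g)`,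
`B₃ = k·Bin(3,g)` on the atoms `0, k, 2k, 3k`. [this work] -/
theorem twoSureOneGated_eq_shift (r k : ℕ) (g c : ℝ) (h : ℕ) :
    lconv ((r + k) + (r + k)) (r + k) (lconv (r + k) (r + k) (blobLaw [(k, g), (r, 1)]) (blobLaw [(k, g), (r, 1)]))
        (gate (blobLaw [(k, g), (r, 1)]) c) h
      = (if 2 * r ≤ h then
          ((fun t => (1 - c) * ((1 - g) ^ 2 * (if t = 0 then (1 : ℝ) else 0) + 2 * g * (1 - g) * (if t = k then (1 : ℝ) else 0)
                + g ^ 2 * (if t = 2 * k then (1 : ℝ) else 0))) (h - 2 * r)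
            + (if r ≤ h - 2 * r then
                (fun t => c * ((1 - g) ^ 3 * (if t = 0 then (1 : ℝ) else 0) + 3 * g * (1 - g) ^ 2 * (if t = k then (1 : ℝ) else 0)
                  + 3 * g ^ 2 * (1 - g) * (if t = 2 * k then (1 : ℝ) else 0) + g ^ 3 * (if t = 3 * k then (1 : ℝ) else 0)))
                  (h - 2 * r - r)
              else 0))
        else 0) := by
  rw [twoSureOneGated_apply]
  simp only [pointLaw]
  by_cases h2 : 2 * r ≤ h
  · rw [if_pos h2]
    rw [ind_sub h2 0, ind_sub h2 k, ind_sub h2 (2 * k), show 2 * r + 0 = 2 * r by ring]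
    by_cases h3 : r ≤ h - 2 * r
    · rw [if_pos h3]
      have h3' : 2 * r + r ≤ h := by omega
      have esub : h - 2 * r - r = h - (2 * r + r) := by omega
      rw [esub, ind_sub h3' 0, ind_sub h3' k, ind_sub h3' (2 * k), ind_sub h3' (3 * k),
        show 2 * r + r + 0 = 3 * r by ring, show 2 * r + r + k = 3 * r + k by ring, show 2 * r + r + 2 * k = 3 * r + 2 * k by ring,
        show 2 * r + r + 3 * k = 3 * r + 3 * k by ring]
    · rw [if_neg h3, if_neg (show ¬ (h = 3 * r) by omega), if_neg (show ¬ (h = 3 * r + k) by omega),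
        if_neg (show ¬ (h = 3 * r + 2 * k) by omega), if_neg (show ¬ (h = 3 * r + 3 * k) by omega)]
      ring
  · rw [if_neg h2, if_neg (show ¬ (h = 2 * r) by omega), if_neg (show ¬ (h = 2 * r + k) by omega),
      if_neg (show ¬ (h = 2 * r + 2 * k) by omega), if_neg (show ¬ (h = 3 * r) by omega), if_neg (show ¬ (h = 3 * r + k) by omega),
      if_neg (show ¬ (h = 3 * r + 2 * k) by omega), if_neg (show ¬ (h = 3 * r + 3 * k) by omega)]
    ring

/-! ### The lift: `ρ ∗ ρ ∗ gate_c ρ` is DEC at floor `(2+c)g/3` at every layer -/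

/-- **THE LIFT `ρ ∗ ρ ∗ gate_c ρ` AT FLOOR `(2+c)g/3` (two sure glued siblings `ρ = blobLaw [(k,g),(r,1)]` beside a `c`-gated copy).**
For `0 < g < 1`, `0 < c ≤ 1` and every layer `j`: `DECAtT ((2+c)g/3) ((2+c)(r+kg)) j (3(r+k)) (ρ ∗ ρ ∗ gate_c ρ)` — DEC at its own mean at a floor
ABOVE the forest's natural floor `c·g`, for EVERY shape `(r, k)` (long tails included).  Proof: the three-blob law at its average gate
(`heavy_threeBlobs`), the gated copy's atoms moved up by `r` (`heavy_shift_partial`), everything moved up by `2r` (`heavy_shift_full`, target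
`+4r ≥ (2+c)r`), read back as `X_c` (`twoSureOneGated_eq_shift`), valid at every layer (`decAtT_of_heavy`). [this work] -/
theorem decAtT_twoSureOneGated (r k : ℕ) {g c : ℝ} (hg0 : 0 < g) (hg1 : g < 1) (hc0 : 0 < c) (hc1 : c ≤ 1) (j : ℕ) :
    DECAtT ((2 + c) * g / 3) ((2 + c) * ((r : ℝ) + k * g)) j ((r + k) + (r + k) + (r + k))
      (lconv ((r + k) + (r + k)) (r + k) (lconv (r + k) (r + k) (blobLaw [(k, g), (r, 1)]) (blobLaw [(k, g), (r, 1)]))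
        (gate (blobLaw [(k, g), (r, 1)]) c)) := by
  have hx1 : (2 + c) * g / 3 ≤ 1 := by nlinarith
  have h1g : 0 ≤ 1 - g := by linarith
  -- the three blobs at their average gate
  have hB := heavy_threeBlobs k hg0 hg1 hc0 hc1
  -- move the gated copy's blobs up by `r`
  have hind : ∀ t a : ℕ, (0 : ℝ) ≤ (if t = a then (1 : ℝ) else 0) := fun t a => by split_ifs <;> norm_num
  have hP := heavy_shift_partial ((2 + c) * g / 3) ((2 + c) * g * k) (3 * k) r _
    (fun t => (1 - c) * ((1 - g) ^ 2 * (if t = 0 then (1 : ℝ) else 0) + 2 * g * (1 - g) * (if t = k then (1 : ℝ) else 0)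
      + g ^ 2 * (if t = 2 * k then (1 : ℝ) else 0)))
    (fun t => c * ((1 - g) ^ 3 * (if t = 0 then (1 : ℝ) else 0) + 3 * g * (1 - g) ^ 2 * (if t = k then (1 : ℝ) else 0)
      + 3 * g ^ 2 * (1 - g) * (if t = 2 * k then (1 : ℝ) else 0) + g ^ 3 * (if t = 3 * k then (1 : ℝ) else 0)))
    hx1 (fun t => rfl)
    (fun t => mul_nonneg (by linarith) (add_nonneg (add_nonneg (mul_nonneg (sq_nonneg _) (hind t 0))
      (mul_nonneg (mul_nonneg (by linarith) h1g) (hind t k))) (mul_nonneg (sq_nonneg _) (hind t (2 * k)))))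
    (fun t => mul_nonneg hc0.le (add_nonneg (add_nonneg (add_nonneg (mul_nonneg (pow_nonneg h1g 3) (hind t 0))
      (mul_nonneg (mul_nonneg (by linarith) (sq_nonneg _)) (hind t k))) (mul_nonneg (mul_nonneg (by positivity) h1g) (hind t (2 * k))))
      (mul_nonneg (pow_nonneg hg0.le 3) (hind t (3 * k)))))
    hB
  -- move everything up by `2r`: target `+ 4r`
  have hF := heavy_shift_full ((2 + c) * g / 3) ((2 + c) * g * k) (3 * k + r) (2 * r) _ hP
  -- read the shifted law as `X_c` and conclude at every layer
  have hD := decAtT_of_heavy ((2 + c) * g / 3) ((2 + c) * g * k + 2 * ((2 * r : ℕ) : ℝ)) (3 * k + r + 2 * r) _ hF j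
  have e : (fun h : ℕ => if 2 * r ≤ h then
          ((fun t => (1 - c) * ((1 - g) ^ 2 * (if t = 0 then (1 : ℝ) else 0) + 2 * g * (1 - g) * (if t = k then (1 : ℝ) else 0)
                + g ^ 2 * (if t = 2 * k then (1 : ℝ) else 0))) (h - 2 * r)
            + (if r ≤ h - 2 * r then
                (fun t => c * ((1 - g) ^ 3 * (if t = 0 then (1 : ℝ) else 0) + 3 * g * (1 - g) ^ 2 * (if t = k then (1 : ℝ) else 0)
                  + 3 * g ^ 2 * (1 - g) * (if t = 2 * k then (1 : ℝ) else 0) + g ^ 3 * (if t = 3 * k then (1 : ℝ) else 0)))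
                  (h - 2 * r - r)
              else 0))
        else 0)
      = lconv ((r + k) + (r + k)) (r + k) (lconv (r + k) (r + k) (blobLaw [(k, g), (r, 1)]) (blobLaw [(k, g), (r, 1)]))
          (gate (blobLaw [(k, g), (r, 1)]) c) := funext fun h => (twoSureOneGated_eq_shift r k g c h).symm
  rw [e] at hD
  have hT : (2 + c) * ((r : ℝ) + k * g) ≤ (2 + c) * g * k + 2 * ((2 * r : ℕ) : ℝ) := by
    have hr0 : (0 : ℝ) ≤ r := Nat.cast_nonneg r
    push_cast; nlinarith [mul_nonneg hr0 (by linarith : (0 : ℝ) ≤ 2 - c)]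
  have hM : 3 * k + r + 2 * r ≤ (r + k) + (r + k) + (r + k) := by omega
  exact decAtT_mono_top (decAtT_antitone_target hT hD) hM

end LawDec
end Quant
end Summit.CriticalPhenomena.PercolationContinuityZ3.Theorems
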